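import Literature.NumberTheory.EllipticCurves.DivisionTowerH1VanishingOfHomothetyProofs
import Literature.NumberTheory.EllipticCurves.ModThreeIrreducibleNegOneProofs
import HarnessLib

/-!
# Howard's H.2 along the `3`-division tower from IRREDUCIBILITY ALONE at `p = 3`:
# `E[3]` irreducible over `K` ⇒ `H¹(Gal(L/K), E(L)[3^j]) = 0` for every finite Galois `L ⊆ K_b(E[3^{m+1}])`

`Proofs`-style file (THEOREMS ONLY: no definition, no named fact, no instance), topic `NumberTheory/EllipticCurves`.
Cell `pub/bsd-print-x9`, seat `bsd-line-x10b-p2` LEAD g4 (row 10, `p = 3`), 2026-08-28.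

COMPOSITION of two tree theorems: the division-tower `H¹`-vanishing from ONE homothety
(`LawsonWuthrich2016.subgroupResKer_geomTorsion_eq_bot_of_smul_eq_neg`, seat `bsd-line-x10b-p1-w2` g5, p633556:
Howard 2004 H.2 / Lawson–Wuthrich 2016 Lemma 3 in tower form, hypothesis "some `σ ∈ Γ_K` acts on `E[p]` as
`−1`", `p` odd) and the `p = 3` image dichotomy (`WeierstrassCurve.exists_smul_eq_neg_of_hasIrreducibleModPGaloisRep_three`,
p634441: every irreducible subgroup of `GL₂(𝔽₃)` contains `−1`). Result: on every frame with `E[3]` irreducible over `K`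
and `3 ≠ 0` in `K` — in particular every X10b frame of the cell's residual μ-letters, where `(irr_K)` is a binder — the
restriction maps `H¹(Γ_K, E[3^j]) → H¹(N, E[3^j])` are injective for every open normal `N ⊇ Γ_{K(E[3^{m+1}])} ⊓ κ⁻¹(3^b ℤ₃)`,
`j ≤ m + 1`: Howard's hypothesis H.2 for `T = T_3E` and for its specialisations `T ⊗ Λ/𝔮_m` (residually `E[3]`) holds on
those frames with NO image hypothesis beyond irreducibility (memo `Cruxes/HowardContainmentAnyClassNumberX10b/P3PortCaveatVoid.md`
§3, now kernel). «beyond-print theorem»: no. BSD is NOT proved by this file; no summit statement is proved by this seat.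

References: B. Howard, Compositio Math. 140 (2004), §1.3 H.2, Lemma 1.6.2 [Howard2004HeegnerKolyvagin];
T. Lawson, C. Wuthrich, "Vanishing of some Galois cohomology groups for elliptic curves" (2016), Lemmas 3–4
[LawsonWuthrich2016]; J.-P. Serre, Invent. Math. 15 (1972), §2 [Serre1972].
-/

set_option autoImplicit false

noncomputable section

open WeierstrassCurve Field Literature.NumberTheory.GaloisRepresentations

universe u

namespace Literature.NumberTheory.EllipticCurves

namespace LawsonWuthrich2016

variable {K : Type u} [Field K] [NumberField K] (W : WeierstrassCurve K)

/-- **Howard's H.2 at `p = 3` from irreducibility alone.** For an elliptic curve `W/K` (`K` a number field)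
with `E[3]` irreducible over `K`, a `ℤ₃`-extension datum `κ`, and every open normal `N ≤ Γ_K` containing
`Γ_{K(E[3^{m+1}])} ⊓ κ⁻¹(3^b ℤ₃)` (i.e. `N = Gal(K̄/L)` for a finite Galois `L ⊆ K_b(E[3^{m+1}])`), and every
`j ≤ m + 1`: `ker (H¹(Γ_K, E[3^j]) → H¹(N, E[3^j])) = 0`. (Some `σ ∈ Γ_K` acts as `−1` on `E[3]`, and `3 ∤ −2`.)
[cite: Howard2004HeegnerKolyvagin, §1.3 hypothesis H.2 and Lemma 1.6.2] [cite: LawsonWuthrich2016, Lemma 3 and Lemma 4] -/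
theorem subgroupResKer_geomTorsion_three_pow_eq_bot_of_irreducible [W.IsElliptic]
    (hirr : W.HasIrreducibleModPGaloisRep 3) (κ : ZpExtension K 3) (b : ℕ) {m j : ℕ} (hj : j ≤ m + 1)
    (N : Subgroup (absoluteGaloisGroup K)) [N.Normal] (hN : IsOpen (N : Set (absoluteGaloisGroup K)))
    (hle : torsionFixing W (((3 : ℕ) : ℤ) ^ (m + 1)) ⊓ κ.layerSubgroup b ≤ N) :
    subgroupResKer (geomTorsion W (((3 : ℕ) : ℤ) ^ j)) N = ⊥ := by
  have h3 : (3 : K) ≠ 0 := by norm_num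
  obtain ⟨σ, hσ⟩ := W.exists_smul_eq_neg_of_hasIrreducibleModPGaloisRep_three h3 hirr
  exact subgroupResKer_geomTorsion_eq_bot_of_smul_eq_neg W (p := 3) (by norm_num) hσ κ b hj N hN hle

/-- **Howard's H.2 at `p = 3`, `E[3]`-coefficients** (the injectivity Howard's Lemma 1.6.2 uses, for `T̄ = E[3]`):
with `E[3]` irreducible over `K`, `H¹(Γ_K, E[3]) → H¹(N, E[3])` is injective for every open normal
`N ⊇ Γ_{K(E[3^{m+1}])} ⊓ κ⁻¹(3^b ℤ₃)`. [cite: Howard2004HeegnerKolyvagin, §1.3 hypothesis H.2 and Lemma 1.6.2]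
[cite: LawsonWuthrich2016, Lemma 3 and Lemma 4] -/
theorem subgroupResKer_geomTorsion_three_eq_bot_of_irreducible [W.IsElliptic]
    (hirr : W.HasIrreducibleModPGaloisRep 3) (κ : ZpExtension K 3) (b m : ℕ)
    (N : Subgroup (absoluteGaloisGroup K)) [N.Normal] (hN : IsOpen (N : Set (absoluteGaloisGroup K)))
    (hle : torsionFixing W (((3 : ℕ) : ℤ) ^ (m + 1)) ⊓ κ.layerSubgroup b ≤ N) :
    subgroupResKer (geomTorsion W ((3 : ℕ) : ℤ)) N = ⊥ := by
  have h := subgroupResKer_geomTorsion_three_pow_eq_bot_of_irreducible W hirr κ b (m := m) (j := 1)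
    (by omega) N hN hle
  rwa [pow_one] at h

end LawsonWuthrich2016

end Literature.NumberTheory.EllipticCurves

end
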